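import Literature.AnabelianGeometry.EtaleTheta.TemperedFrobenioidOfThetaTwistTower
import HarnessLib

/-!
# [EtTh] §5 at the (β) theta-tower carrier: the class of the ZERO divisor of `Θ̈` is fixed by every covering automorphism — the content of the junction input `hθ` (hence `hinvc`) at abc-iut-L2-d2's FILE 4 (Prop. 1.4 (i) p.244, §5 p.330, Prop. 4.3 (i) proof p.317 / PDF pp.18, 104, 91)

S. Mochizuki, *The étale theta function and its Frobenioid-theoretic manifestations*, Publ. RIMS **45** (2009) [MochizukiEtTh2009],
Prop. 1.4 (i) p.244 (PDF p.18) («`Θ̈` has zeroes of order 1 at the cusps» — the zero divisor of `Θ̈` is the sum of ALL cusps with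
multiplicity one, permuted by `Π^tp_X`), §5 p.330 (PDF p.104) («the zero divisor `Div(s^⊓_N)` … descends … to `Φ(A_⊚)`»), Prop. 4.3 (i)
proof p.317 (PDF p.91).  [cite: MochizukiEtTh2009, Prop 1.4 (i) p.244 (PDF p.18); §5 p.330 (PDF p.104)]

abc-iut cell, layer L2 = [EtTh], seat abc-iut-L2-t11 (gen 10); abc-iut-L2-lead R1172 «HINVC-MOVER SIZING» → «HTHETA@FILE4».  PROOF-ONLY
(0 definitions, no instance / notation / `Prop` fact); nothing landed is edited.  Consumed BY NAME: abc-iut-L2-d2's FILE 4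
`ThetaTwistTowerTempered.temperedFrobenioid` (p493549) with its `thetaZeros_mem_Φ` / `Φ₀_map_hom_eq`, abc-iut-L2-t3's theta skeleton
(`TateTowerTheta.thetaZerosPhi` — the CONSTANT equivariant family of value `thetaZeros`, `actDIV_thetaZeros`) and weak realification engine
(`rlfMapWeak_toRealification_of`), [FrdI] `pull`.

CONTEXT (the last class-G binder of the EtTh:Lem5.8 / Thm5.10(ii)(iii) closers).  The junction input
`hinvc : ∀ g : Aut R.AN.base, pull tf.divisorMonoid g.hom (div R.pair.num) = div R.pair.num` REDUCES (abc-iut-L2-t4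
`ThetaFrobenioid.hinvc_of_thetaDivisor`, abc-iut-L2-t3 `hinvc_ofQuotientTemperoid`) to print's input
`hθ : ∀ x : Π^tp_X, pull tf.divisorMonoid (galoisSurj A_⊙^bs x) (div Pl.num) = div Pl.num` — the stability of the ZERO divisor of the
fraction pair of `Θ̈` on `A_⊙` — which is a property of the DATUM `(tf, θ, Pl)`, not a theorem of the junction (the POLAR part moves:
`TateTowerTheta.actDIV_thetaPoles_ne`).  THIS FILE proves that property AT THE CARRIER OF RECORD: for abc-iut-L2-d2's tempered Frobenioid over
the ε-free (β) theta tower, the class `ι_A(div₀ Θ̈) ∈ Φ(A)` of the zero divisor of `Θ̈` (all cusps, multiplicity 1 — `thetaZeros_mem_Φ`)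
is FIXED by every endomorphism — in particular every automorphism `galoisSurj x`, `x ∈ Π^tp` — of every connected covering `A`
(`pull_divisorMonoid_thetaZeros`, `pull_divisorMonoid_thetaZeros_aut`): the zero divisor is a CONSTANT equivariant family, so it pulls
back to itself, and FILE 4's transition of `Φ₀` is «pull back, then raise to the ramification index», `eN i i = 1` along an endomorphism
(along a genuine covering map `A' → A` the class pulls back to the `eN (lvl A) (lvl A')`-th power of the class at `A'` — ramification at
the cusps — so the invariance statement is the endomorphism one, which is exactly the quantifier shape of `hθ` / `hinvc`).  Once the
fraction pair `Pl` of `Θ̈` at this carrier is chosen with `div Pl.num := ι(div₀ Θ̈)` (abc-iut-L2-d2's MU-TORSION / (O9) lane supplies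
`θ, Pl, Rl, R`), `hθ` is this theorem and `hinvc` follows BY NAME.  HONEST TWIN
(`LogDivisorModel.TateTowerTheta.not_exists_phiZero_const_thetaPoles`): the POLAR divisor `D₁` of `Θ̈` is NOT a constant equivariant
family over any `Γ`-set carrying a non-trivial translation (abc-iut-L2-t3's `actDIV_thetaPoles_ne`; Rmk. 1.3.1 «does not descend») — so the
swapped pair has no Galois-stable numerator: `hθ` is decided by the datum, at the carrier.
HONEST FRAMING: kernel facts about OUR model carrier; nothing of [EtTh] is asserted or denied; no side taken on [IUTchIII] Cor. 3.12;
typed ≠ proved.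
-/

noncomputable section

namespace Literature.AnabelianGeometry.EtaleTheta

open CategoryTheory Opposite Function Literature.AlgebraicGeometry.Frobenioids Literature.AnabelianGeometry.SemiGraphs

/-! ### Honest twin: the POLAR divisor of `Θ̈` is NOT a constant equivariant family (it does not descend) -/

namespace LogDivisorModel.TateTowerTheta

variable {Γ : Type} [Group Γ] (φ : Γ →* Multiplicative ℤ) (S : Action (Type 0) Γ)

/-- **Why the statement is about the ZERO divisor**: over any `Γ`-set `S` on which some non-trivial translation `g` (`φ g ≠ 1`) acts,
there is NO equivariant family of log-divisors with the CONSTANT value the polar divisor `D₁` of `Θ̈` — `D₁` is moved by every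
non-trivial translation (`actDIV_thetaPoles_ne`; print Rmk. 1.3.1: «`D_1` … does not descend»).  So the swapped fraction pair of `Θ̈`
(numerator := polar part) has no Galois-stable numerator divisor: the junction input `hθ` is a property of the datum, decidable only at
the carrier.  [cite: MochizukiEtTh2009, Rmk 1.3.1 p.247 (PDF p.21); Prop 1.4 (ii) p.244 (PDF p.18)] -/
theorem not_exists_phiZero_const_thetaPoles [Nonempty S.V] {g : Γ} (hg : φ g ≠ 1) :
    ¬ ∃ ψ : (action φ).phiZero S, ∀ s, ψ.1 s = (thetaPoles : model.DIV) := by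
  rintro ⟨ψ, hψ⟩
  obtain ⟨s⟩ := ‹Nonempty S.V›
  have h := ψ.2.2 g s
  rw [hψ, hψ] at h
  exact actDIV_thetaPoles_ne φ hg h.symm

end LogDivisorModel.TateTowerTheta

namespace ThetaTwistTowerTempered

open LogDivisorModel.TateTowerThetaTwist TateTowerKummerTwistRShear
open TateTowerKummerTwist (eN eN_self)

variable (R S : ((ConnectedPart (BTemp (Compat 3 thetaShear)))ᵒᵖ ⥤ CommMonCat.{0}) → Prop)

/-- **The zero-divisor class of `Θ̈` is FIXED by every endomorphism of every connected covering** — in particular by every covering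
automorphism `galoisSurj x`, `x ∈ Π^tp`: the content of the junction input `hθ` (§5 p.330: `Div(s^⊓_N)` descends; Prop. 4.3 (i) proof) AT
abc-iut-L2-d2's FILE 4 carrier.  The zero divisor of `Θ̈` is the CONSTANT equivariant family of value «all cusps × 1» (Prop. 1.4 (i)), so it
pulls back to itself, and FILE 4's transition of `Φ₀` along an ENDOmorphism raises to the ramification index `eN i i = 1`.  (Along a
genuine covering map `A' → A` the class pulls back to the `eN (lvl A) (lvl A')`-th power of the class at `A'` — ramification at the cusps —
which is why the statement is about endomorphisms.)  With a fraction pair `Pl` of `Θ̈` at this carrier whose numerator divisor is this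
class, `hθ` is this theorem and `hinvc` follows by abc-iut-L2-t4's `ThetaFrobenioid.hinvc_of_thetaDivisor`.
[cite: MochizukiEtTh2009, Prop 1.4 (i) p.244 (PDF p.18); §5 p.330 (PDF p.104); Prop 4.3 (i) p.317 (PDF p.91)] -/
theorem pull_divisorMonoid_thetaZeros {A : ConnectedPart (BTemp (Compat 3 thetaShear))} (g : A ⟶ A) :
    pull (temperedFrobenioid R S).divisorMonoid g ⟨_, thetaZeros_mem_Φ R S A⟩ = ⟨_, thetaZeros_mem_Φ R S A⟩ := by
  apply Subtype.ext
  -- the constant family pulls back to the constant family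
  have hψ : (LogDivisorModel.TateTowerTheta.action φ₃).phiZeroPull g.hom.hom
        (LogDivisorModel.TateTowerTheta.thetaZerosPhi φ₃ (LogDivisorTower.gset A)) =
      LogDivisorModel.TateTowerTheta.thetaZerosPhi φ₃ (LogDivisorTower.gset A) :=
    Subtype.ext (funext fun _ => rfl)
  -- FILE 4's transition of `Φ₀` along an endomorphism: pull back, then raise to `eN i i = 1`
  have h2 : (dm.Φ₀.map g.op).hom (LogDivisorModel.TateTowerTheta.thetaZerosPhi φ₃ (LogDivisorTower.gset A)) =
      LogDivisorModel.TateTowerTheta.thetaZerosPhi φ₃ (LogDivisorTower.gset A) := by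
    rw [Φ₀_map_hom_eq]
    change (LogDivisorModel.TateTowerTheta.action φ₃).phiZeroPull g.hom.hom
        (LogDivisorModel.TateTowerTheta.thetaZerosPhi φ₃ (LogDivisorTower.gset A)) ^
          eN (lvlC 3 thetaShear A) (lvlC 3 thetaShear A) = _
    rw [eN_self, pow_one, hψ]
  -- the weak realification engine on the image of `Φ₀`
  have h1 := rlfMapWeak_toRealification_of dm.Φ₀ hpf g.op
    (LogDivisorModel.TateTowerTheta.thetaZerosPhi φ₃ (LogDivisorTower.gset A))
  rw [h2] at h1
  exact h1

/-- The same for automorphisms `g ∈ Aut(A)` (the quantifier shape of `hinvc` / of `hθ` through `Π^tp ↠ Aut(A^bs)`).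
[cite: MochizukiEtTh2009, §5 p.330 (PDF p.104)] -/
theorem pull_divisorMonoid_thetaZeros_aut {A : ConnectedPart (BTemp (Compat 3 thetaShear))} (g : Aut A) :
    pull (temperedFrobenioid R S).divisorMonoid g.hom ⟨_, thetaZeros_mem_Φ R S A⟩ = ⟨_, thetaZeros_mem_Φ R S A⟩ :=
  pull_divisorMonoid_thetaZeros R S g.hom

end ThetaTwistTowerTempered

end Literature.AnabelianGeometry.EtaleTheta

end
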